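import Mathlib
import HarnessLib
import Summits.NavierStokesRegularity.NavierStokesRegularity.Theorems.UnthreadedDoorNetFluxDefs
import Summits.NavierStokesRegularity.NavierStokesRegularity.Theorems.UnthreadedDoorCellFluxDefs
import Summits.NavierStokesRegularity.NavierStokesRegularity.Theorems.UnthreadedDoorCellFluxGlue
import Literature.Analysis.FluidPDE.AxisymmetricEuler

/-!
# Route `UnthreadedDoor`, crux `PoloidalLiouville` (stmt-NavierStokesRegularity-1222), WALL W1 — Theorems-side DEFS TWIN of the
# Z skeleton `Cruxes/PoloidalLiouville/CellFluxZSkeleton.lean` v1.1 (c6ae0be7f8d8, custodian ns-idea-14 g6; critic ns-wall-crit-1 V22)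

Statement-only file (definitions + sorry-free kernel glue; NO stubs, NO proofs of the four steps).  It lands, in the Theorems
namespace `…Theorems.PoloidalLiouville.CellFlux`, the frame vocabulary of the Z skeleton (`conjAxis`, `IsAxisymmetricNoSwirlAbout`),
its four stub statements Z-1a `ZonalKinematic`, Z-1b `AxisFrozen`, Z-2 `ForwardVanishing`, Z-3 `KNSSTransfer` with bodies VERBATIM
(so that each Cruxes-side `stub_X` closes BY NAME from a Theorems-side `theorem x : X`), and the kernel-checked composition
`zonalUnthreadedVorticityVanishes_of : ZonalKinematic → AxisFrozen → ForwardVanishing → KNSSTransfer → ZonalUnthreadedVorticityVanishes`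
concluding the LANDED decl `CellFlux.ZonalUnthreadedVorticityVanishes` (p692073) by name (pure logic, copy of the skeleton's §3).

* Z-1a `ZonalKinematic` (kinematic, one slice): zonal + unthreaded + `div ω = 0` ⇒ after cocycle averaging `v t − c` is EXACTLY axisymmetric
  without swirl about the axis `x₀ + ℝe`, in a frame `R`.
* Z-1b `AxisFrozen` (dynamic): on an interval `(-∞, t₁]` of non-vanishing vorticity ONE frame works and the constant is absorbed.
* Z-2 `ForwardVanishing`: `ω(a) ≡ 0 ⇒ ω ≡ 0` on `[a, 0)` (Oseen gauge + forward uniqueness from a constant datum).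
* Z-3 `KNSSTransfer`: a fixed no-swirl frame on `(-∞, t₁]` ⇒ `ω ≡ 0` there (time shift, translation / isometry covariance, the PROVED
  `Literature.Analysis.FluidPDE.knss_axisymmetric_no_swirl_holds`).

BOOKING (critic V22-P6 (a)): Z is «KNSS Thm 5.2 in a moving frame», information-grade for W1 (movement 0).  NS regularity is NOT proved;
1222 `PoloidalLiouville`, Z and the four statements below are OPEN here (this file proves only the composition).
-/

noncomputable section

set_option linter.dupNamespace false

open Set Function Filter Topology MeasureTheory
open scoped RealInnerProductSpace

namespace Summit.NavierStokesRegularity.NavierStokesRegularity.Theorems.PoloidalLiouville.CellFlux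

open Summit.NavierStokesRegularity.NavierStokesRegularity.Theorems.PoloidalLiouville.NetFlux (E3)
open Literature.Analysis Literature.Analysis.FluidPDE

/-! ### §0 Frame vocabulary (verbatim from the Z skeleton) -/

/-- The slice `u` seen from the frame in which the axis through `p` with direction `R.symm e_z` becomes the `x₂`-axis through `0`:
`(conjAxis R p u) y = R (u (R⁻¹ y + p))`. -/
def conjAxis (R : E3 ≃ₗᵢ[ℝ] E3) (p : E3) (u : E3 → E3) : E3 → E3 :=
  fun y => R (u (R.symm y + p))

/-- «`u` is axisymmetric WITHOUT SWIRL about the axis through `p` that the frame `R` straightens to the `x₂`-axis» — the tree's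
`IsAxisymmetric` / `HasNoSwirl` (KNSS vocabulary, `Literature.Analysis.FluidPDE.AxisymmetricEuler`) after conjugation. -/
def IsAxisymmetricNoSwirlAbout (R : E3 ≃ₗᵢ[ℝ] E3) (p : E3) (u : E3 → E3) : Prop :=
  IsAxisymmetric (conjAxis R p u) ∧ HasNoSwirl (conjAxis R p u)

/-- Unfolding lemma for `conjAxis`. -/
theorem conjAxis_apply (R : E3 ≃ₗᵢ[ℝ] E3) (p : E3) (u : E3 → E3) (y : E3) :
    conjAxis R p u y = R (u (R.symm y + p)) := rfl

/-! ### §1 The four stub statements (verbatim from the Z skeleton) -/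

/-- Z-1a (kinematic, one slice at a time; M−). OPEN here. -/
def ZonalKinematic : Prop :=
  ∀ (v : ℝ → E3 → E3) (x₀ : E3) (T : ℝ → E3 → ℝ),
    IsBoundedAncientMildSolution 1 v → (∀ t < 0, AEStronglyMeasurable (v t) volume) →
    ContDiffOn ℝ (⊤ : ℕ∞) (uncurry v) (Iio 0 ×ˢ univ) →
    (∀ t < 0, ∀ x, curl (v t) x = cross (gradient (T t) x) (x - x₀)) →
    (∀ t < 0, ∃ e : E3, e ≠ 0 ∧ ∀ x, inner ℝ e (curl (v t) x) = 0) →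
    ∀ t < 0, ∃ (R : E3 ≃ₗᵢ[ℝ] E3) (c : E3), IsAxisymmetricNoSwirlAbout R x₀ (fun y => v t y - c)

/-- Z-1b (dynamic axis freezing on an interval of non-vanishing vorticity; M). OPEN here. -/
def AxisFrozen : Prop :=
  ∀ (v : ℝ → E3 → E3) (x₀ : E3) (T : ℝ → E3 → ℝ),
    IsBoundedAncientMildSolution 1 v → (∀ t < 0, AEStronglyMeasurable (v t) volume) →
    ContDiffOn ℝ (⊤ : ℕ∞) (uncurry v) (Iio 0 ×ˢ univ) →
    (∀ t < 0, ∀ x, curl (v t) x = cross (gradient (T t) x) (x - x₀)) →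
    (∀ t < 0, ∃ (R : E3 ≃ₗᵢ[ℝ] E3) (c : E3), IsAxisymmetricNoSwirlAbout R x₀ (fun y => v t y - c)) →
    ∀ t₁ < 0, (∀ t ≤ t₁, ∃ x, curl (v t) x ≠ 0) →
    ∃ R : E3 ≃ₗᵢ[ℝ] E3, ∀ t ≤ t₁, IsAxisymmetricNoSwirlAbout R x₀ (v t)

/-- Z-2 (forward vanishing of the vorticity; S/M−). OPEN here. -/
def ForwardVanishing : Prop :=
  ∀ (v : ℝ → E3 → E3),
    IsBoundedAncientMildSolution 1 v → (∀ t < 0, AEStronglyMeasurable (v t) volume) →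
    ContDiffOn ℝ (⊤ : ℕ∞) (uncurry v) (Iio 0 ×ˢ univ) →
    ∀ a < 0, (∀ x, curl (v a) x = 0) → ∀ t, a ≤ t → t < 0 → ∀ x, curl (v t) x = 0

/-- Z-3 (KNSS Thm 5.2 transferred to a fixed frame on `(-∞, t₁]`; M−). OPEN here. -/
def KNSSTransfer : Prop :=
  ∀ (v : ℝ → E3 → E3) (x₀ : E3),
    IsBoundedAncientMildSolution 1 v → (∀ t < 0, AEStronglyMeasurable (v t) volume) →
    ContDiffOn ℝ (⊤ : ℕ∞) (uncurry v) (Iio 0 ×ˢ univ) →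
    ∀ t₁ < 0, ∀ R : E3 ≃ₗᵢ[ℝ] E3, (∀ t ≤ t₁, IsAxisymmetricNoSwirlAbout R x₀ (v t)) →
    ∀ t ≤ t₁, ∀ x, curl (v t) x = 0

/-! ### §2 Kernel-checked composition (copy of the skeleton's §3, concluding the landed decl by name) -/

/-- **Z from the four statements** (pure logic): if `ω(t₁) ≢ 0`, forward vanishing (Z-2, contrapositive) gives `ω(t) ≢ 0` for every
`t ≤ t₁`; the kinematic representation (Z-1a) and axis freezing (Z-1b) give ONE frame on `(-∞, t₁]`; the KNSS transfer (Z-3) gives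
`ω(t₁) ≡ 0` — contradiction. -/
theorem zonalUnthreadedVorticityVanishes_of (h1a : ZonalKinematic) (h1b : AxisFrozen) (h2 : ForwardVanishing)
    (h3 : KNSSTransfer) : ZonalUnthreadedVorticityVanishes := by
  intro v x₀ T hB hm hsv hlink hzon t₁ ht₁ x
  by_contra hx
  have hnv : ∀ t ≤ t₁, ∃ y, curl (v t) y ≠ 0 := by
    intro t ht
    by_contra hall
    simp only [ne_eq, not_exists, not_not] at hall
    exact hx (h2 v hB hm hsv t (lt_of_le_of_lt ht ht₁) hall t₁ ht ht₁ x)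
  obtain ⟨R, hR⟩ := h1b v x₀ T hB hm hsv hlink (h1a v x₀ T hB hm hsv hlink hzon) t₁ ht₁ hnv
  exact hx (h3 v x₀ hB hm hsv t₁ ht₁ R hR t₁ le_rfl x)

/-- **The zonal Type-I rung from the four statements**: composed with the landed kernel glue `zonal_of_vanishes`
(`UnthreadedDoorCellFluxGlue`, p693177), the four Z statements give Σ-Z `ZonalTypeIScalarLiouville`. -/
theorem zonalTypeIScalarLiouville_of (h1a : ZonalKinematic) (h1b : AxisFrozen) (h2 : ForwardVanishing)
    (h3 : KNSSTransfer) : ZonalTypeIScalarLiouville :=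
  zonal_of_vanishes (zonalUnthreadedVorticityVanishes_of h1a h1b h2 h3)

/-- **Analytic-in-frame or irrotational from the four statements and Σ-5a** (kernel glue `analyticOrIrrotational_of`, p693177). -/
theorem unthreadedAnalyticOrIrrotational_of (h5a : UnthreadedGaugeRigidity) (h1a : ZonalKinematic) (h1b : AxisFrozen)
    (h2 : ForwardVanishing) (h3 : KNSSTransfer) : UnthreadedAnalyticOrIrrotational :=
  analyticOrIrrotational_of h5a (zonalUnthreadedVorticityVanishes_of h1a h1b h2 h3)

end Summit.NavierStokesRegularity.NavierStokesRegularity.Theorems.PoloidalLiouville.CellFlux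

end
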